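import Summits.CriticalPhenomena.CardyFormulaZ2.Theorems.CardyBoundaryCoulombGasHalfPlaneMarkDensityLawSelfDualityExact
import Summits.CriticalPhenomena.CardyFormulaZ2.Theorems.CardyBoundaryCoulombGasHalfPlaneMarkDensityLawEquicontinuity
import Literature.Probability.Percolation.Z2HalfPlaneThreeArm

/-!
# `HalfPlaneMarkDensityLaw` (crux stmt-CriticalPhenomena-5661), line `Sketch`, cycle 2 (gap closing):
# glue G6' — the lattice bound `1 − C₁((γ−β)/R)^α ≤ P[[α',β] ↔ [γ,δ] in H]` gives the continuum bound
# `P_n(a,b,c,y) ≥ 1 − C₁(2(c−b)/d)^α` eventually, for `K(c−b) < d ≤ min (b−a) (y−c)`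

Pure floor arithmetic.  With `P_n(a,b,c,y) = P_{1/2}[[⌊an⌋,⌊bn⌋]×{0} ↔ [⌊cn⌋,⌊yn⌋]×{0} in ℤ×ℕ]`
(`arcA a b n = rowIcc ⌊an⌋ ⌊bn⌋`), apply the lattice bound at scale `n` with
`α' = ⌊an⌋, β = ⌊bn⌋, γ = ⌊cn⌋, δ = ⌊yn⌋, R = ⌊dn⌋₊` and the same constants `C₁, α`, `K = K₁`:
for `n` large the six lattice hypotheses hold (`γ − β ≤ (c−b)n + 1`, `R ≥ dn − 1`,
`δ − γ + 1 > (y−c)n ≥ dn ≥ R`, `β − α' + 1 > (b−a)n ≥ dn ≥ R`) and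
`(γ−β)/R ≤ ((c−b)n+1)/(dn−1) ≤ 2(c−b)/d` once `(c−b)dn ≥ d + 2(c−b)`, so monotonicity of `t ↦ t^α`
turns `1 − C₁((γ−β)/R)^α ≤ P_n` into `1 − C₁(2(c−b)/d)^α ≤ P_n`.
-/

noncomputable section

namespace Summit.CriticalPhenomena.CardyFormulaZ2.Cruxes.HalfPlaneMarkDensityLaw.SketchLine

open Literature.Probability.Percolation Literature.Probability.LatticeModels
open Literature.Probability.Percolation.Z2HalfPlane (leg Far faceBox oneArm)
open MeasureTheory Filter Set SimpleGraph
open scoped Topology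
open Summit.CriticalPhenomena.CardyFormulaZ2.Theorems.HalfPlaneMarkDensityLaw.Negative

namespace GapClose

/-- Eventually in `n`, `C ≤ κ n` for `κ > 0`. [folklore] -/
private theorem eventually_const_le_mul_nat {κ : ℝ} (hκ : 0 < κ) (C : ℝ) :
    ∀ᶠ n : ℕ in atTop, C ≤ κ * n :=
  (tendsto_natCast_atTop_atTop.const_mul_atTop hκ).eventually_ge_atTop C

/-- **The lattice data at scale `n`.**  For `a < b < c < y` and `K₁(c−b) < d ≤ min (b−a) (y−c)`,
eventually in `n` the floors `α' = ⌊an⌋, β = ⌊bn⌋, γ = ⌊cn⌋, δ = ⌊yn⌋` and `R = ⌊dn⌋₊` satisfy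
`α' ≤ β < γ ≤ δ`, `K₁(γ−β) ≤ R ≤ min (δ−γ+1) (β−α'+1)`, `0 < R` and `(γ−β)/R ≤ 2(c−b)/d`.
[folklore] -/
private theorem eventually_latticeData {K₁ : ℕ} {a b c y d : ℝ} (hab : a < b) (hbc : b < c)
    (hcy : c < y) (hKd : (K₁ : ℝ) * (c - b) < d) (hda : d ≤ b - a) (hdy : d ≤ y - c) :
    ∀ᶠ n : ℕ in atTop,
      ⌊a * n⌋ ≤ ⌊b * n⌋ ∧ ⌊b * n⌋ < ⌊c * n⌋ ∧ ⌊c * n⌋ ≤ ⌊y * n⌋ ∧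
      (K₁ : ℤ) * (⌊c * n⌋ - ⌊b * n⌋) ≤ (⌊d * n⌋₊ : ℕ) ∧
      ((⌊d * n⌋₊ : ℕ) : ℤ) ≤ ⌊y * n⌋ - ⌊c * n⌋ + 1 ∧
      ((⌊d * n⌋₊ : ℕ) : ℤ) ≤ ⌊b * n⌋ - ⌊a * n⌋ + 1 ∧
      (0 : ℝ) < (⌊d * n⌋₊ : ℕ) ∧
      (((⌊c * n⌋ : ℤ) : ℝ) - ((⌊b * n⌋ : ℤ) : ℝ)) / ((⌊d * n⌋₊ : ℕ) : ℝ) ≤ 2 * (c - b) / d := by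
  have hcb : 0 < c - b := sub_pos.2 hbc
  have hK0 : (0 : ℝ) ≤ K₁ := Nat.cast_nonneg K₁
  have hd : 0 < d := lt_of_le_of_lt (mul_nonneg hK0 hcb.le) hKd
  have hgap : 0 < d - K₁ * (c - b) := sub_pos.2 hKd
  have hcbd : 0 < (c - b) * d := mul_pos hcb hd
  filter_upwards [eventually_const_le_mul_nat hcb 1, eventually_const_le_mul_nat hgap K₁,
    eventually_const_le_mul_nat hcbd (d + 2 * (c - b)), eventually_const_le_mul_nat hd 1]
    with n hn1 hn2 hn3 hn4
  -- the floors against the reals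
  have ha0 : ((⌊a * (n : ℝ)⌋ : ℤ) : ℝ) ≤ a * n := Int.floor_le _
  have ha1 : a * n < ((⌊a * (n : ℝ)⌋ : ℤ) : ℝ) + 1 := Int.lt_floor_add_one _
  have hb0 : ((⌊b * (n : ℝ)⌋ : ℤ) : ℝ) ≤ b * n := Int.floor_le _
  have hb1 : b * n < ((⌊b * (n : ℝ)⌋ : ℤ) : ℝ) + 1 := Int.lt_floor_add_one _
  have hc0 : ((⌊c * (n : ℝ)⌋ : ℤ) : ℝ) ≤ c * n := Int.floor_le _
  have hc1 : c * n < ((⌊c * (n : ℝ)⌋ : ℤ) : ℝ) + 1 := Int.lt_floor_add_one _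
  have hy1 : y * n < ((⌊y * (n : ℝ)⌋ : ℤ) : ℝ) + 1 := Int.lt_floor_add_one _
  have hdn : 0 ≤ d * n := by positivity
  have hR0 : ((⌊d * (n : ℝ)⌋₊ : ℕ) : ℝ) ≤ d * n := Nat.floor_le hdn
  have hR1 : d * n - 1 < ((⌊d * (n : ℝ)⌋₊ : ℕ) : ℝ) := Nat.sub_one_lt_floor _
  have hRpos : (0 : ℝ) < ((⌊d * (n : ℝ)⌋₊ : ℕ) : ℝ) := by linarith
  have hda' : d * n ≤ (b - a) * n := mul_le_mul_of_nonneg_right hda n.cast_nonneg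
  have hdy' : d * n ≤ (y - c) * n := mul_le_mul_of_nonneg_right hdy n.cast_nonneg
  refine ⟨Subseq.floor_mul_le_floor_mul hab.le n, ?_, Subseq.floor_mul_le_floor_mul hcy.le n,
    ?_, ?_, ?_, hRpos, ?_⟩
  · -- `β < γ`
    have h : ((⌊b * (n : ℝ)⌋ : ℤ) : ℝ) < ((⌊c * (n : ℝ)⌋ : ℤ) : ℝ) := by nlinarith
    exact Int.cast_lt.1 h
  · -- `K₁ (γ − β) ≤ R`
    have hmul : (K₁ : ℝ) * (((⌊c * (n : ℝ)⌋ : ℤ) : ℝ) - ((⌊b * (n : ℝ)⌋ : ℤ) : ℝ)) ≤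
        K₁ * ((c - b) * n + 1) :=
      mul_le_mul_of_nonneg_left (by linarith) hK0
    have h : (((K₁ : ℤ) * (⌊c * (n : ℝ)⌋ - ⌊b * (n : ℝ)⌋) : ℤ) : ℝ) <
        ((((⌊d * (n : ℝ)⌋₊ : ℕ) : ℤ) + 1 : ℤ) : ℝ) := by
      push_cast
      linarith
    have := Int.cast_lt.1 h
    omega
  · -- `R ≤ δ − γ + 1`
    have h : ((((⌊d * (n : ℝ)⌋₊ : ℕ) : ℤ) : ℤ) : ℝ) <
        ((⌊y * (n : ℝ)⌋ - ⌊c * (n : ℝ)⌋ + 1 : ℤ) : ℝ) := by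
      push_cast
      linarith
    exact (Int.cast_lt.1 h).le
  · -- `R ≤ β − α' + 1`
    have h : ((((⌊d * (n : ℝ)⌋₊ : ℕ) : ℤ) : ℤ) : ℝ) <
        ((⌊b * (n : ℝ)⌋ - ⌊a * (n : ℝ)⌋ + 1 : ℤ) : ℝ) := by
      push_cast
      linarith
    exact (Int.cast_lt.1 h).le
  · -- the ratio `(γ − β)/R ≤ 2(c − b)/d`
    rw [div_le_div_iff₀ hRpos hd]
    have hnum : (((⌊c * (n : ℝ)⌋ : ℤ) : ℝ) - ((⌊b * (n : ℝ)⌋ : ℤ) : ℝ)) * d ≤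
        ((c - b) * n + 1) * d :=
      mul_le_mul_of_nonneg_right (by linarith) hd.le
    have hden : 2 * (c - b) * (d * n - 1) ≤ 2 * (c - b) * ((⌊d * (n : ℝ)⌋₊ : ℕ) : ℝ) :=
      mul_le_mul_of_nonneg_left hR1.le (by positivity)
    linarith

/-- STUB G6' (glue): G5 gives G6 (floors).  Take the same `C₁, α` and `K = K₁`; at scale `n` apply the
lattice bound to `α' = ⌊an⌋, β = ⌊bn⌋, γ = ⌊cn⌋, δ = ⌊yn⌋, R = ⌊dn⌋₊` (`eventually_latticeData`) and use
`(γ−β)/R ≤ 2(c−b)/d` with the monotonicity of `t ↦ t^α`. [folklore] -/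
theorem stub_eventually_ge_one_sub_of :
    (∃ C₁ α : ℝ, 0 < C₁ ∧ 0 < α ∧ ∃ K₁ : ℕ, 1 ≤ K₁ ∧ ∀ (α' β γ δ : ℤ) (R : ℕ), α' ≤ β → β < γ → γ ≤ δ → (K₁ : ℤ) * (γ - β) ≤ R → (R : ℤ) ≤ δ - γ + 1 → (R : ℤ) ≤ β - α' + 1 → 1 - C₁ * (((γ : ℝ) - β) / R) ^ α ≤ μ.real (openCrossing halfPlane (rowIcc α' β) (rowIcc γ δ))) →
    ∃ C₁ α K : ℝ, 0 < C₁ ∧ 0 < α ∧ 0 < K ∧ ∀ (a b c y d : ℝ), a < b → b < c → c < y → K * (c - b) < d → d ≤ b - a → d ≤ y - c → ∀ᶠ n : ℕ in atTop, 1 - C₁ * (2 * (c - b) / d) ^ α ≤ μ.real (openCrossing halfPlane (arcA a b n) (rowIcc ⌊c * n⌋ ⌊y * n⌋)) := by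
  rintro ⟨C₁, α, hC₁, hα, K₁, hK, h⟩
  refine ⟨C₁, α, K₁, hC₁, hα, Nat.cast_pos.2 (by omega), ?_⟩
  intro a b c y d hab hbc hcy hKd hda hdy
  filter_upwards [eventually_latticeData hab hbc hcy hKd hda hdy] with n hn
  obtain ⟨h1, h2, h3, h4, h5, h6, hRpos, hratio⟩ := hn
  have key := h _ _ _ _ _ h1 h2 h3 h4 h5 h6
  have hnum : (0 : ℝ) ≤ ((⌊c * (n : ℝ)⌋ : ℤ) : ℝ) - ((⌊b * (n : ℝ)⌋ : ℤ) : ℝ) := by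
    have : ((⌊b * (n : ℝ)⌋ : ℤ) : ℝ) < ((⌊c * (n : ℝ)⌋ : ℤ) : ℝ) := Int.cast_lt.2 h2
    linarith
  have hpow : ((((⌊c * (n : ℝ)⌋ : ℤ) : ℝ) - ((⌊b * (n : ℝ)⌋ : ℤ) : ℝ)) / ((⌊d * (n : ℝ)⌋₊ : ℕ) : ℝ)) ^ α ≤
      (2 * (c - b) / d) ^ α :=
    Real.rpow_le_rpow (div_nonneg hnum hRpos.le) hratio hα.le
  have hmul := mul_le_mul_of_nonneg_left hpow hC₁.le
  rw [Subseq.arcA_eq_rowIcc]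
  linarith

end GapClose

end Summit.CriticalPhenomena.CardyFormulaZ2.Cruxes.HalfPlaneMarkDensityLaw.SketchLine
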